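import Summits.HodgeConjecture.HodgeConjecture.Theorems.CyclicUnitaryPowersFiveFacts
import Literature.AlgebraicGeometry.HodgeTheory.UnitaryReflectionGroupZariskiDenseHolds
import Literature.AlgebraicGeometry.HodgeTheory.CyclicCoverDeckInvariantsTransfer

/-!
# K1 `VeryGeneralDeckCommutatorsInHg` of route `CyclicUnitaryPowers` from the Carlson–Toledo family AT PRIMES ONLY
# (stmt-HodgeConjecture-19544; the composition of `CyclicUnitaryPowersFiveFacts` with its family input restricted to
# the generality the crux consumes: `p` prime, `p ≥ 7`)

Prover seat `hodge-nonav-prover-Ax` (g9), cell `hodge-nonav`. Landed `--supports stmt-HodgeConjecture-19544`; sorry-free,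
no definition, no new named fact. CONDITIONAL results; nothing here says HC ∕ HC_AV is proved; rung F-H1 is not moved.

`CyclicUnitaryPowersFiveFacts.veryGeneralDeckCommutatorsInHg_of_five_facts` takes the bundled cited fact
`nonempty_carlsonToledoFamily : ∀ p, Odd p → 3 ≤ p → Nonempty (CarlsonToledoFamily p)` but USES it only at the
crux's `p` (prime, `≥ 7`). When the Picard–Lefschetz package is derived from the `σ`-free local monodromy of the
`A_{p−1}` degeneration (`carlsonToledo1999_nodalMeridianLocalMonodromy`, prover-Ax g9), the identification of the
meridian monodromy with a power of the covering transformation (`CyclicReflectionRecognition`) needs `Φ_p`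
irreducible of degree `p − 1 = dim V`, i.e. `p` PRIME; so the family is then available at primes only. This file
records the same K1 composition with the family hypothesis in that generality:

* `veryGeneralDeckCommutatorsInHg_of_five_facts_prime` — verbatim the five-facts proof with
  `hCT : ∀ p, p.Prime → 7 ≤ p → Nonempty (CarlsonToledoFamily p)`;
* `veryGeneralDeckCommutatorsInHg_of_prime_family` — with CT1 (`carlsonToledo1999_finrank_eigenspace_deck_one_holds`)
  and CT71 (`carlsonToledo1999_unitaryReflection_zariskiDense_holds`) discharged: K1 ⟸ {family at primes ≥ 7, CT2,
  CDK}; `cyclicSurfacePowersHodge_of_prime_family` — the rung leaf likewise.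

## References

* [CarlsonToledo1999] J. A. Carlson, D. Toledo, Duke Math. J. 97 (1999), §2, §3, §5, §6, §7 Theorem 7.1.
* [CarlsonMullerStachPeters2017] J. Carlson, S. Müller-Stach, C. Peters, Period Mappings and Period Domains,
  2nd ed., Lemma–Definition 15.3.7.
* [CattaniDeligneKaplan1995] E. Cattani, P. Deligne, A. Kaplan, J. Amer. Math. Soc. 8 (1995), Thm. 1.1, Cor. 1.2.
-/

noncomputable section


set_option linter.dupNamespace false

namespace Summit.HodgeConjecture.HodgeConjecture.Theorems.CyclicUnitaryPowersFiveFactsPrime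

open Literature.AlgebraicGeometry.Motives Literature.AlgebraicGeometry.HodgeTheory
open Literature.AlgebraicGeometry.HodgeTheory.BettiUniverse
open Literature.AlgebraicTopology.SingularHomology
open CategoryTheory
open Summit.HodgeConjecture.HodgeConjecture.Theorems.CyclicUnitaryPowersDeckModelClauses

/-- **K1 `VeryGeneralDeckCommutatorsInHg` from the five Carlson–Toledo / Hodge-locus inputs, the family being
given AT PRIMES `p ≥ 7` ONLY** (the generality the crux consumes). Verbatim the composition
`CyclicUnitaryPowersFiveFacts.veryGeneralDeckCommutatorsInHg_of_five_facts` (K1 on the models; very general ⇒ Hodge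
generic by CDK; `Γ' ≤ MT` of finite index by CMSP 15.3.7 proved; commutators of transported `σ`-unitary
automorphisms in `(⁅Γ', Γ'⁆)^Zar ⊆ Hg`), with the family hypothesis instantiated at the crux's prime.
[cite: CarlsonToledo1999, §2 and §7 Theorem 7.1] [cite: CarlsonMullerStachPeters2017, Lemma–Definition 15.3.7] -/
theorem veryGeneralDeckCommutatorsInHg_of_five_facts_prime
    (hCT : ∀ ⦃p : ℕ⦄, p.Prime → 7 ≤ p → Nonempty (CarlsonToledoFamily p))
    (hCT1 : carlsonToledo1999_finrank_eigenspace_deck_one)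
    (hCT2 : carlsonToledo1999_finrank_eigenspace_inf_hodgePiece)
    (hCT71 : carlsonToledo1999_unitaryReflection_zariskiDense)
    (hCDK : cmsp_nonHodgeGenericPoints_countable_algebraic_cover) :
    Summit.HodgeConjecture.HodgeConjecture.Theses.CyclicUnitaryPowers.VeryGeneralDeckCommutatorsInHg := by
  have hDeckH := Summit.HodgeConjecture.HodgeConjecture.Theorems.CyclicUnitaryPowersDeckHodgeOfCarlsonToledo.cyclicDeckHodge_of_carlsonToledo hCT1 hCT2
  refine Summit.HodgeConjecture.HodgeConjecture.Theorems.CyclicUnitaryPowersModelTransfer.stub_cyclicModelTransfer ?_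
  intro p hp h7
  obtain ⟨𝔉⟩ := hCT hp h7
  haveI hHTF : HodgeTensorFacts.{0, 0} := hodgeTensorFacts_holds
  haveI : ∀ t : ComplexPoints 𝔉.S, Module.Finite ℚ (bettiCohomology (fiberOver 𝔉.u t) 2) := fun t => 𝔉.finite t 2
  -- real (hence Hodge-symmetric) Hodge models of the fibres
  have hAm := fun t : ComplexPoints 𝔉.S =>
    exists_isReal_hodgeModel_holds.exists_isHodgeSymmetric (𝔉.isSmoothProjectiveFamily.isSmoothProjective t)
  let A : ∀ t : ComplexPoints 𝔉.S, HodgeModel 2 (fiberOver 𝔉.u t) := fun t => (hAm t).choose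
  have hA : ∀ t, (A t).IsHodgeSymmetric := fun t => (hAm t).choose_spec
  -- the Cattani–Deligne–Kaplan cover of the non-Hodge-generic points of the base
  obtain ⟨W, hW, hcov⟩ := hCDK 𝔉.u 2 2 𝔉.isSmoothProjectiveFamily 𝔉.isQuasiProjectiveOver 𝔉.smooth
    𝔉.irreducibleSpace 𝔉.locallyTrivial A hA
  -- each member of the cover is avoided off one nonzero polynomial condition on the coefficients
  choose G hG₀ hG using fun j => 𝔉.alg (W j) (hW j).1 (hW j).2
  -- the bad family: the coordinate `a_(x₀^p)` (forcing `f ≠ 0`) followed by the `G j`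
  have hdeg : (Finsupp.single (0 : Fin 3) p).degree = p := by simp [Finsupp.degree_single]
  refine ⟨fun i => if i = 0 then MvPolynomial.X ⟨Finsupp.single 0 p, hdeg⟩ else G (i - 1), ?_, ?_⟩
  · intro i
    by_cases hi : i = 0
    · subst hi
      refine ⟨MvPolynomial.X 0 ^ p, by simpa using (MvPolynomial.isHomogeneous_X ℂ (0 : Fin 3)).pow p, ?_⟩
      simp [MvPolynomial.coeff_X_pow]
    · simpa only [hi, if_false] using hG₀ (i - 1)
  intro f hf hgen' hXF ha
  have hf0 : f ≠ 0 := by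
    rintro rfl
    exact hgen' 0 (by simp)
  have hgen : ∀ j, MvPolynomial.eval (fun d : {d : Fin 3 →₀ ℕ // d.degree = p} => f.coeff d.1) (G j) ≠ 0 :=
    fun j => by simpa only [Nat.succ_ne_zero, if_false, Nat.add_sub_cancel] using hgen' (j + 1)
  -- the deck clauses on the model: (o)–(ii) routine (landed), (iii)–(iv) from the Carlson–Toledo facts
  obtain ⟨ha', h1, h2⟩ := exists_cyclicDeckModel_clauses_one_two hp.ne_zero f hXF
  obtain ⟨h3, h4⟩ := hDeckH hp h7 f hf hf0 hXF ha
  have h1' : pull (diagonalAut (MvPolynomial.X (Fin.last 3) ^ p - MvPolynomial.rename Fin.castSucc f) ha) 2 ^ p = 1 := by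
    rw [diagonalAut_congr _ ha ha' rfl]; exact h1
  have h2' : ∀ x y, tr hXF (2 + 2) (cup _ 2 2
      (pull (diagonalAut (MvPolynomial.X (Fin.last 3) ^ p - MvPolynomial.rename Fin.castSucc f) ha) 2 x)
      (pull (diagonalAut (MvPolynomial.X (Fin.last 3) ^ p - MvPolynomial.rename Fin.castSucc f) ha) 2 y)) =
      tr hXF (2 + 2) (cup _ 2 2 x y) := by
    rw [diagonalAut_congr _ ha ha' rfl]; exact h2
  refine ⟨⟨h1', h2', h3, h4⟩, ?_⟩
  intro g h hg hh
  -- the envelope kit of the fibre over the classifying point `s = pt f`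
  have hXF' : IsSmoothProjective 2 (SmoothHypersurface.hypersurface (cyclicCoverForm p f)) := hXF
  have haF : deckUnit p ∈ diagonalStabilizer (cyclicCoverForm p f) := ha
  obtain ⟨φ, B, hBs, hBn, τ, hτp, R, hτB, hφτ, hφB, hHG, hfix, hP1, hP2, hP3, hP4, hP5⟩ :=
    𝔉.exists_envelopeKit f hf hf0 hXF' haF exists_isReal_hodgeModel_holds hodgePQ_independent_of_hodgeModel_holds
      h1' h2' h3.le (A (𝔉.pt f)) (hA (𝔉.pt f))
  -- re-type `φ` on the route's spelling of the model (`cyclicCoverForm p f` unfolds to it), so that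
  -- `simp` lemmas match syntactically below
  obtain ⟨φ, rfl⟩ : ∃ φ' : bettiCohomology (fiberOver 𝔉.u (𝔉.pt f)) 2 ≃ₗ[ℚ]
      bettiCohomology (SmoothHypersurface.hypersurface
        (MvPolynomial.X (Fin.last 3) ^ p - MvPolynomial.rename Fin.castSucc f)) 2, φ' = φ := ⟨φ, rfl⟩
  haveI := finite hXF 2
  -- the kit clauses used below, on the route's spelling of the model
  have hφτ' : ∀ x, φ (τ x) =
      pull (diagonalAut (MvPolynomial.X (Fin.last 3) ^ p - MvPolynomial.rename Fin.castSucc f) ha) 2 (φ x) := hφτ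
  have hφB' : ∀ x y, B x y = tr hXF (2 + 2) (cup (SmoothHypersurface.hypersurface
      (MvPolynomial.X (Fin.last 3) ^ p - MvPolynomial.rename Fin.castSucc f)) 2 2 (φ x) (φ y)) := hφB
  have hHG' : ∀ k : bettiCohomology (fiberOver 𝔉.u (𝔉.pt f)) 2 ≃ₗ[ℚ] bettiCohomology (fiberOver 𝔉.u (𝔉.pt f)) 2,
      k ∈ ((A (𝔉.pt f)).hodgeStructure (𝔉.isSmoothProjectiveFamily.isSmoothProjective (𝔉.pt f)) (hA (𝔉.pt f)) 2).hodgeGroup →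
        (φ.symm.trans k).trans φ ∈ (hodge exists_isReal_hodgeModel_holds hXF 2).hodgeGroup := hHG
  -- the classifying point of a very general member is Hodge generic
  have hsgen : IsHodgeGenericPoint 𝔉.u 2 𝔉.locallyTrivial 𝔉.isSmoothProjectiveFamily A hA ⟨𝔉.pt f, Set.mem_univ _⟩ := by
    by_contra hns
    obtain ⟨j, hj⟩ := hcov ⟨𝔉.pt f, Set.mem_univ _⟩ hns
    exact hG j f hf hXF (hgen j) hj
  -- CMSP 15.3.7 (i), now a THEOREM for this family (quasi-projective total space, irreducible base): a
  -- finite-index subgroup `Γ'` of the monodromy group lies in `MT(H²(𝒳_s))`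
  obtain ⟨Γ', hΓ'le, hΓ'fi, hΓ'MT⟩ := (deligne_finiteIndex_monodromy_le_mumfordTateGroup_of_isQuasiProjectiveOver 𝔉.u 2 2
    𝔉.isSmoothProjectiveFamily 𝔉.isQuasiProjectiveOver_total 𝔉.isQuasiProjectiveOver 𝔉.smooth 𝔉.irreducibleSpace
    𝔉.locallyTrivial A hA
    ⟨𝔉.pt f, Set.mem_univ _⟩ hsgen).1
  -- transport the two σ-unitary automorphisms to the fibre
  have hστ : ∀ y, τ (φ.symm y) =
      φ.symm (pull (diagonalAut (MvPolynomial.X (Fin.last 3) ^ p - MvPolynomial.rename Fin.castSucc f) ha) 2 y) :=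
    fun y => by
    apply φ.injective
    rw [hφτ', LinearEquiv.apply_symm_apply, LinearEquiv.apply_symm_apply]
  have cenτ : ∀ k : bettiCohomology (SmoothHypersurface.hypersurface
        (MvPolynomial.X (Fin.last 3) ^ p - MvPolynomial.rename Fin.castSucc f)) 2 ≃ₗ[ℚ]
      bettiCohomology (SmoothHypersurface.hypersurface
        (MvPolynomial.X (Fin.last 3) ^ p - MvPolynomial.rename Fin.castSucc f)) 2,
      (∀ x, k (pull (diagonalAut (MvPolynomial.X (Fin.last 3) ^ p - MvPolynomial.rename Fin.castSucc f) ha) 2 x) =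
        pull (diagonalAut (MvPolynomial.X (Fin.last 3) ^ p - MvPolynomial.rename Fin.castSucc f) ha) 2 (k x)) →
      ∀ x, ((φ.trans k).trans φ.symm) (τ x) = τ (((φ.trans k).trans φ.symm) x) := by
    intro k hk x
    simp only [LinearEquiv.trans_apply]
    rw [hφτ', hk, hστ]
  have cenB : ∀ k : bettiCohomology (SmoothHypersurface.hypersurface
        (MvPolynomial.X (Fin.last 3) ^ p - MvPolynomial.rename Fin.castSucc f)) 2 ≃ₗ[ℚ]
      bettiCohomology (SmoothHypersurface.hypersurface
        (MvPolynomial.X (Fin.last 3) ^ p - MvPolynomial.rename Fin.castSucc f)) 2,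
      (∀ x y, tr hXF (2 + 2) (cup (SmoothHypersurface.hypersurface
          (MvPolynomial.X (Fin.last 3) ^ p - MvPolynomial.rename Fin.castSucc f)) 2 2 (k x) (k y)) =
        tr hXF (2 + 2) (cup (SmoothHypersurface.hypersurface
          (MvPolynomial.X (Fin.last 3) ^ p - MvPolynomial.rename Fin.castSucc f)) 2 2 x y)) →
      ∀ x y, B (((φ.trans k).trans φ.symm) x) (((φ.trans k).trans φ.symm) y) = B x y := by
    intro k hk x y
    simp only [LinearEquiv.trans_apply]
    rw [hφB', LinearEquiv.apply_symm_apply, LinearEquiv.apply_symm_apply, hk, ← hφB']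
  -- B2: the commutator of the transported pair lies in the ℚ-Zariski closure of `⁅Γ', Γ'⁆`
  have hc : ((φ.trans g).trans φ.symm) * ((φ.trans h).trans φ.symm) * ((φ.trans g).trans φ.symm)⁻¹ *
      ((φ.trans h).trans φ.symm)⁻¹ ∈ glZariskiClosure ⁅Γ', Γ'⁆ :=
    CyclicUnitaryPowersLaneDCommutatorClosure.unitaryReflectionDensity_of_CT71 @hCT71
      (bettiCohomology (fiberOver 𝔉.u (𝔉.pt f)) 2) B τ p R (ratMonodromyGroup 𝔉.u 2 𝔉.locallyTrivial ⟨𝔉.pt f, Set.mem_univ _⟩)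
      hp h7 hBs hBn hτp hτB hfix hP1 hP2 hP3 hP4 hP5 Γ' hΓ'le hΓ'fi
      ((φ.trans g).trans φ.symm) ((φ.trans h).trans φ.symm) (cenτ g hg.1) (cenB g hg.2) (cenτ h hh.1) (cenB h hh.2)
  -- B1 (landed, any weight): `(⁅Γ', Γ'⁆)^Zar(ℚ) ⊆ Hg` for `Γ' ≤ MT`, the fibre's Hodge structure being polarizable
  have hcomm := mem_hodgeGroup_of_mem_glZariskiClosure_commutator
    ((A (𝔉.pt f)).hodgeStructure (𝔉.isSmoothProjectiveFamily.isSmoothProjective (𝔉.pt f)) (hA (𝔉.pt f)) 2)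
    (smoothProjective_hodgeStructure_isPolarizable_holds (𝔉.isSmoothProjectiveFamily.isSmoothProjective (𝔉.pt f))
      (A (𝔉.pt f)) (hA (𝔉.pt f)) 2) hΓ'MT hc
  -- transport back to `H²(X_F;ℚ)` along `φ`
  have hback := hHG' _ hcomm
  have hid : (φ.symm.trans (((φ.trans g).trans φ.symm) * ((φ.trans h).trans φ.symm) * ((φ.trans g).trans φ.symm)⁻¹ *
      ((φ.trans h).trans φ.symm)⁻¹)).trans φ = g * h * g⁻¹ * h⁻¹ := by
    ext x
    simp only [LinearEquiv.mul_apply, LinearEquiv.trans_apply, LinearEquiv.coe_inv, LinearEquiv.symm_trans_apply,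
      LinearEquiv.symm_symm, LinearEquiv.apply_symm_apply]
  rw [← hid]
  exact hback

/-- **K1 from the Carlson–Toledo family at primes `p ≥ 7`, the eigen-Hodge numbers CT2 and the CDK cover** (the
invariant line CT1 and the density theorem CT71 are tree theorems:
`carlsonToledo1999_finrank_eigenspace_deck_one_holds`, `carlsonToledo1999_unitaryReflection_zariskiDense_holds`).
CONDITIONAL; nothing here says HC ∕ HC_AV is proved.
[cite: CarlsonToledo1999, §2, §5 and §7 Theorem 7.1] [cite: CattaniDeligneKaplan1995, Thm. 1.1 and Cor. 1.2] -/
theorem veryGeneralDeckCommutatorsInHg_of_prime_family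
    (hCT : ∀ ⦃p : ℕ⦄, p.Prime → 7 ≤ p → Nonempty (CarlsonToledoFamily p))
    (hCT2 : carlsonToledo1999_finrank_eigenspace_inf_hodgePiece)
    (hCDK : cmsp_nonHodgeGenericPoints_countable_algebraic_cover) :
    Summit.HodgeConjecture.HodgeConjecture.Theses.CyclicUnitaryPowers.VeryGeneralDeckCommutatorsInHg :=
  veryGeneralDeckCommutatorsInHg_of_five_facts_prime hCT carlsonToledo1999_finrank_eigenspace_deck_one_holds @hCT2
    carlsonToledo1999_unitaryReflection_zariskiDense_holds @hCDK

/-- **The rung leaf `CyclicSurfacePowersHodge` (stmt-HodgeConjecture-19543) from the same inputs** (via the landed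
fact-free step `cyclicSurfacePowersHodge_of_veryGeneralDeckCommutatorsInHg`). CONDITIONAL; rung F-H1 not moved.
[cite: CarlsonToledo1999, §2, §5 and §7 Theorem 7.1] [cite: CattaniDeligneKaplan1995, Thm. 1.1 and Cor. 1.2] -/
theorem cyclicSurfacePowersHodge_of_prime_family
    (hCT : ∀ ⦃p : ℕ⦄, p.Prime → 7 ≤ p → Nonempty (CarlsonToledoFamily p))
    (hCT2 : carlsonToledo1999_finrank_eigenspace_inf_hodgePiece)
    (hCDK : cmsp_nonHodgeGenericPoints_countable_algebraic_cover) :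
    Summit.HodgeConjecture.HodgeConjecture.Theses.CyclicUnitaryPowers.CyclicSurfacePowersHodge :=
  CyclicUnitaryPowersCyclicSurfacePowersHodge.cyclicSurfacePowersHodge_of_veryGeneralDeckCommutatorsInHg
    (veryGeneralDeckCommutatorsInHg_of_prime_family @hCT @hCT2 @hCDK)

end Summit.HodgeConjecture.HodgeConjecture.Theorems.CyclicUnitaryPowersFiveFactsPrime

end
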